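import Literature.Claims.NS.ClayVariants
import Literature.Analysis.FluidPDE.ClassicalSolutionTorusProofs
import Literature.Analysis.FluidPDE.ClassicalSolutionGalilean
import Literature.Analysis.FluidPDE.PeriodicGalileanNonuniqueness
import Literature.Analysis.FluidPDE.NSLerayHopf
import Literature.Analysis.FunctionSpaces.FlatTorusProofs
import HarnessLib

/-!
# Clay (B) from GLOBAL CLASSICAL SOLUTIONS ON THE TORUS FOR MEAN-ZERO DATA — the Δ1/Δ4 bridge

Reference file for the cell `ns-claims` (D-0090): several periodic claims (C22 `Chaabani2020`, C76
`Davlatov2020`, …) are typed at the level of the flat unit torus `𝕋³ = UnitAddTorus (Fin 3)` and — because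
the tree's torus well-posedness vocabulary (`Literature.Analysis.FluidPDE.Torus.exists_maximal_classicalNS`,
Robinson–Rodrigo–Sadowski 2016 §6.3/§8.1) is written for MEAN-ZERO data — for mean-zero data, while Clay's
(B) (`ClayVariants.clayPeriodic.Regularity`) asks for smooth `ℤ³`-periodic solutions on `ℝ³ × [0,∞)` from
ARBITRARY smooth divergence-free periodic data. The typists record this as a «ClayDelta» (e.g.
`Literature.Claims.NS.Chaabani2020.ClayDelta`). This file discharges that delta once and for all:

* `solvable_of_torus_global_sub_const` — if `(W, P)` is a global classical solution on `𝕋³ × [0,∞)`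
  whose initial slice lifts to `u₀ − m` for some constant vector `m`, then the Cauchy problem from `u₀`
  is solvable in the Clay sense, in BOTH the printed and the errata reading of (B) (velocity AND pressure
  periodic): lift to `ℝ³` (`IsClassicalNSSolutionOn.of_torus_holds`, Lemarié-Rieusset 2016 §1.3), undo
  the Galilean change of frame `u(t,y) = W(t, y − tm) + m`, `p(t,y) = P(t, y − tm)` (Majda–Bertozzi 2002
  §1.2; tree `IsClassicalNSSolutionOn.galileanBoost_const`), read the result through
  `isNavierStokesSolution_and_smooth_iff`;
* `exists_meanZero_descend` — every smooth divergence-free `ℤ³`-periodic datum `u₀` on `ℝ³` is `lift w₀ + m`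
  with `w₀` smooth, divergence free and of zero mean on `𝕋³` (`m` = the mean, `w₀` = the descent of
  `u₀ − m`);
* `clayPeriodic_regularityAt_of_torus_meanZero`, `clayPeriodic_regularity_of_torus_meanZero` (and the
  errata twins): torus-level global classical solvability for smooth divergence-free MEAN-ZERO data at
  viscosity `ν` implies `clayPeriodic.RegularityAt ν` / Clay (B).

All statements are bookkeeping around published facts (Galilean invariance, periodic ⇄ torus); nothing
here bears on the truth of (B).

WHAT THIS IS NOT: not a claim about NS regularity or blow-up; not a claim about any author beyond the
typed locator.
-/

noncomputable section

open Set MeasureTheory Function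
open scoped ContDiff

namespace Literature.Claims.NS.ClayVariants

open Literature.Analysis Literature.Analysis.FluidPDE Literature.Analysis.FunctionSpaces

/-- **Undoing the Galilean normalisation of the mean.** Let `(W, P)` be a classical solution of the
unforced Navier–Stokes equations with viscosity `ν` on `𝕋³ × [0,∞)` whose initial velocity lifts to
`u₀ − m` (`m` a constant vector). Then `u(t,y) = W(t, y − tm) + m`, `p(t,y) = P(t, y − tm)` (read on the
periodic lifts) is a smooth solution on `ℝ³ × [0,∞)` from `u₀` with `u(·,t)` AND `p(·,t)` periodic: the
problem from `u₀` is solvable in the sense of Clay (B) as printed and in the errata reading (Galilean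
invariance, Majda–Bertozzi 2002 §1.2; periodic fields on `ℝ³` = fields on `ℝ³/ℤ³`, Lemarié-Rieusset 2016
§1.3). [cite: MajdaBertozzi2002, §1.2] [cite: FeffermanClay2006, (B) with (8) (10) (11), p. 2] -/
theorem solvable_of_torus_global_sub_const {ν : ℝ} {u₀ : (EuclideanSpace ℝ (Fin 3)) → (EuclideanSpace ℝ (Fin 3))} (m : (EuclideanSpace ℝ (Fin 3)))
    {W : ℝ → UnitAddTorus (Fin 3) → (EuclideanSpace ℝ (Fin 3))} {P : ℝ → UnitAddTorus (Fin 3) → ℝ}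
    (hW : Torus.IsClassicalNSSolutionOn (Ici 0) ν 0 W P)
    (hW0 : ∀ y : (EuclideanSpace ℝ (Fin 3)), Torus.lift (W 0) y = u₀ y - m) :
    clayPeriodic.Solvable ν 0 u₀ ∧ clayPeriodicErrata.Solvable ν 0 u₀ := by
  -- lift to `ℝ³`
  have hR3 : FluidPDE.IsClassicalNSSolutionOn (Ici 0) ν (0 : ℝ → (EuclideanSpace ℝ (Fin 3)) → (EuclideanSpace ℝ (Fin 3)))
      (fun t => Torus.lift (W t)) (fun t => Torus.lift (P t)) := by
    have h0 : (fun t => Torus.lift ((0 : ℝ → UnitAddTorus (Fin 3) → (EuclideanSpace ℝ (Fin 3))) t)) = (0 : ℝ → (EuclideanSpace ℝ (Fin 3)) → (EuclideanSpace ℝ (Fin 3))) := rfl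
    rw [← h0]
    exact IsClassicalNSSolutionOn.of_torus_holds hW
  -- Galilean frame with velocity `-m`
  have hB := hR3.galileanBoost_const (uniqueDiffOn_Ici 0) (-m)
  set U : ℝ → (EuclideanSpace ℝ (Fin 3)) → (EuclideanSpace ℝ (Fin 3)) := fun t y => Torus.lift (W t) (y + t • (-m)) - (-m) with hU
  set Q : ℝ → (EuclideanSpace ℝ (Fin 3)) → ℝ := fun t y => Torus.lift (P t) (y + t • (-m)) with hQ
  have hB' : FluidPDE.IsClassicalNSSolutionOn (Ici 0) ν (0 : ℝ → (EuclideanSpace ℝ (Fin 3)) → (EuclideanSpace ℝ (Fin 3))) U Q := hB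
  have hU0 : U 0 = u₀ := by
    funext y
    show Torus.lift (W 0) (y + (0 : ℝ) • (-m)) - (-m) = u₀ y
    rw [zero_smul, add_zero, hW0, sub_neg_eq_add, sub_add_cancel]
  obtain ⟨hns, hUs, hQs⟩ := isNavierStokesSolution_and_smooth_iff.mpr ⟨hB', hU0⟩
  have hUper : ∀ t : ℝ, IsLatticePeriodic (U t) := fun t => by
    have h1 : IsLatticePeriodic (Torus.lift (W t)) := Torus.isLatticePeriodic_lift (W t)
    exact (h1.comp_add_right (t • (-m))).sub_const (-m)
  have hQper : ∀ t : ℝ, IsLatticePeriodic (Q t) := fun t => by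
    have h1 : IsLatticePeriodic (Torus.lift (P t)) := Torus.isLatticePeriodic_lift (P t)
    exact h1.comp_add_right (t • (-m))
  exact ⟨⟨U, Q, hUs, hQs, hns, fun t _ => hUper t⟩,
    ⟨U, Q, hUs, hQs, hns, fun t _ => ⟨hUper t, hQper t⟩⟩⟩

/-- **The mean-zero descent of a periodic datum.** Every smooth divergence-free `ℤ³`-periodic field `u₀`
on `ℝ³` is `y ↦ lift w₀ y + m` with `m` its mean over a period cell and `w₀` a smooth divergence-free
MEAN-ZERO field on `𝕋³` (the descent of `u₀ − m`; Lemarié-Rieusset 2016 §1.3, periodic fields on `ℝ³` =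
fields on `ℝ³/ℤ³`; the mean is a Galilean velocity, Majda–Bertozzi 2002 §1.2).
[cite: LemarieRieusset2016, §1.3 eqs. (1.10)–(1.13)] -/
theorem exists_meanZero_descend {u₀ : (EuclideanSpace ℝ (Fin 3)) → (EuclideanSpace ℝ (Fin 3))} (hsmooth : ContDiff ℝ ∞ u₀)
    (hdiv : NSWave0.IsDivFree u₀) (hper : IsLatticePeriodic u₀) :
    ∃ (m : (EuclideanSpace ℝ (Fin 3))) (w₀ : UnitAddTorus (Fin 3) → (EuclideanSpace ℝ (Fin 3))), Torus.IsSmooth w₀ ∧ Torus.IsDivFree w₀ ∧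
      Torus.HasZeroMean w₀ ∧ ∀ y : (EuclideanSpace ℝ (Fin 3)), Torus.lift w₀ y = u₀ y - m := by
  -- the descended datum and its mean
  set v₀ : UnitAddTorus (Fin 3) → (EuclideanSpace ℝ (Fin 3)) := Torus.descend u₀ hper with hv₀
  have hlv₀ : Torus.lift v₀ = u₀ := Torus.lift_descend_holds u₀ hper
  have hv₀s : Torus.IsSmooth v₀ := by
    show ContDiff ℝ ∞ (Torus.lift v₀)
    rw [hlv₀]; exact hsmooth
  set m : (EuclideanSpace ℝ (Fin 3)) := ∫ x, v₀ x with hm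
  -- the mean-free part, as the descent of `u₀ − m`
  have hperm : IsLatticePeriodic (fun y => u₀ y - m) := hper.sub_const m
  set w₀ : UnitAddTorus (Fin 3) → (EuclideanSpace ℝ (Fin 3)) := Torus.descend (fun y => u₀ y - m) hperm with hw₀
  have hlw₀ : Torus.lift w₀ = fun y => u₀ y - m := Torus.lift_descend_holds (fun y => u₀ y - m) hperm
  have hw₀v : ∀ x, w₀ x = v₀ x - m := fun x => rfl
  have hw₀s : Torus.IsSmooth w₀ := by
    show ContDiff ℝ ∞ (Torus.lift w₀)
    rw [hlw₀]; exact hsmooth.sub contDiff_const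
  refine ⟨m, w₀, hw₀s, ?_, ?_, fun y => by rw [hlw₀]⟩
  · -- divergence free: the lift is `u₀ − m`, whose divergence is that of `u₀`
    refine (FluidPDE.isDivFree_lift_iff (hw₀s.isContDiff (by simp))).1 ?_
    rw [hlw₀]
    intro y
    have h : VectorCalculus.divergence (fun z => u₀ z - m) y = NSWave0.divergence u₀ y := by
      simp only [VectorCalculus.divergence, NSWave0.divergence, fderiv_sub_const]
    rw [h]
    exact hdiv y
  · -- zero mean
    show ∫ x, w₀ x = 0
    simp_rw [hw₀v]
    rw [integral_sub hv₀s.integrable (integrable_const m), integral_const, hm]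
    simp

/-- **Torus-level global solvability for mean-zero data at viscosity `ν` gives `clayPeriodic.RegularityAt ν`
and its errata twin** (the Δ1/Δ4 bridge of the periodic claim skeletons: lift + Galilean normalisation of
the mean). [cite: FeffermanClay2006, (B) with (8) (10) (11), p. 2] -/
theorem clayPeriodic_regularityAt_of_torus_meanZero {ν : ℝ}
    (H : ∀ w₀ : UnitAddTorus (Fin 3) → (EuclideanSpace ℝ (Fin 3)), Torus.IsSmooth w₀ → Torus.IsDivFree w₀ →
      Torus.HasZeroMean w₀ →
      ∃ (W : ℝ → UnitAddTorus (Fin 3) → (EuclideanSpace ℝ (Fin 3))) (P : ℝ → UnitAddTorus (Fin 3) → ℝ),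
        Torus.IsClassicalNSSolutionOn (Ici 0) ν 0 W P ∧ W 0 = w₀) :
    clayPeriodic.RegularityAt ν ∧ clayPeriodicErrata.RegularityAt ν := by
  have key : ∀ u₀ : (EuclideanSpace ℝ (Fin 3)) → (EuclideanSpace ℝ (Fin 3)), ContDiff ℝ ∞ u₀ → NSWave0.IsDivFree u₀ → IsLatticePeriodic u₀ →
      clayPeriodic.Solvable ν 0 u₀ ∧ clayPeriodicErrata.Solvable ν 0 u₀ := by
    intro u₀ hs hdiv hper
    obtain ⟨m, w₀, hw₀s, hw₀d, hw₀m, hlift⟩ := exists_meanZero_descend hs hdiv hper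
    obtain ⟨W, P, hW, hW0⟩ := H w₀ hw₀s hw₀d hw₀m
    exact solvable_of_torus_global_sub_const m hW (fun y => by rw [hW0]; exact hlift y)
  exact ⟨fun u₀ hs hdiv hper => (key u₀ hs hdiv hper).1, fun u₀ hs hdiv hper => (key u₀ hs hdiv hper).2⟩

/-- **Clay (B) from torus-level global solvability for mean-zero data at every `ν > 0`** — verbatim the
«ClayDelta» of the periodic claim skeletons typed over the mean-zero torus class (e.g.
`Literature.Claims.NS.Chaabani2020.ClayDelta`), now a theorem; with the errata reading as a bonus.
[cite: FeffermanClay2006, (B) with (8) (10) (11), p. 2] -/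
theorem clayPeriodic_regularity_of_torus_meanZero
    (H : ∀ ν : ℝ, 0 < ν → ∀ w₀ : UnitAddTorus (Fin 3) → (EuclideanSpace ℝ (Fin 3)), Torus.IsSmooth w₀ → Torus.IsDivFree w₀ →
      Torus.HasZeroMean w₀ →
      ∃ (W : ℝ → UnitAddTorus (Fin 3) → (EuclideanSpace ℝ (Fin 3))) (P : ℝ → UnitAddTorus (Fin 3) → ℝ),
        Torus.IsClassicalNSSolutionOn (Ici 0) ν 0 W P ∧ W 0 = w₀) :
    clayPeriodic.Regularity ∧ clayPeriodicErrata.Regularity :=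
  ⟨fun ν hν => (clayPeriodic_regularityAt_of_torus_meanZero (H ν hν)).1,
    fun ν hν => (clayPeriodic_regularityAt_of_torus_meanZero (H ν hν)).2⟩

end Literature.Claims.NS.ClayVariants
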